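import Mathlib
import Summits.NavierStokesRegularity.NavierStokesRegularity.Theorems.EulerZoomLiouvillePowerGaugeEulerLiouvilleSelfSimilarSwirlRatchet
import Summits.NavierStokesRegularity.NavierStokesRegularity.Theorems.EulerZoomLiouvillePowerGaugeEulerLiouvilleSelfSimilarPastStrata
import Literature.Analysis.FluidPDE.PineauVicolRSSProofs
import HarnessLib

/-!
# Crux E `PowerGaugeEulerLiouville` (stmt-NavierStokesRegularity-19832), THE ONE STATEMENT: THE SWIRL RATCHET, II — SLOW channels carry no swirl,
# and the past twins (width seat ns-ezl-w3 g3; sequel of `…SelfSimilarSwirlRatchet`)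

Route №10 `EulerZoomLiouville` (NavierStokesRegularity), crux E; LEAD ns-typeII-p2 g12.  The ratchet `Γ(Y t) = e^{(1−2γ)t} Γ(Y 0)` along backward similarity orbits
(`SwirlRatchet.swirl_backward_orbit`) kills the swirl not only when `Γ = swirl U = r U_θ` is bounded, but whenever the backward orbits escape to infinity SLOWER than the ratchet
turns: with linear growth `‖U y‖ ≤ K₁(1+‖y‖)` one has `|Γ(z)| ≤ ‖z‖‖U z‖ ≤ K₁(‖z‖ + ‖z‖²)` (`|⟪J z, U z⟫| ≤ ‖J z‖‖U z‖`, `‖J z‖ ≤ ‖z‖`), and a one-sided INFLOW BOUND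
`⟪z, γz + U z⟫ ≥ −(c₁‖z‖² + D)` (radial inflow rate at most `γ + c₁` up to a bounded core) confines backward orbits to `‖Y t‖² ≤ (‖y‖² + D/c₁)e^{2c₁t}`
(`SwirlRatchet.norm_sq_backward_orbit_le`, one-sided Grönwall).  Hence:

* `SwirlRatchet.hasNoSwirl_of_slowInflow` — `γ < ½`, linear growth, inflow excess `c₁` with `2c₁ < 1 − 2γ` ⇒ `U` is swirl-free (`|Γ(y)|e^{(1−2γ)t} ≤ C e^{2c₁t}`).
  In the class (`γ = 1/(2+ρ)`, `1 − 2γ = ρ/(2+ρ)`): a swirling axisymmetric `C²` needle of linear growth has radial inflow excess `> ρ/(2(2+ρ))` beyond every bounded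
  core — `inf_z (⟪z, W z⟫ + c₁‖z‖²) = −∞` for every `c₁ < ρ/(2(2+ρ))`.
* MEMBER FORMS: `SwirlRatchet.selfSimilar_ae_eq_zero_of_axisym_slowInflow_C2` (centred) and the PAST TWINS about any `(T, x₀)`, `T₁ ≤ min 0 T`, of both ratchet strata:
  `…_of_axisym_boundedSwirl_C2_past`, `…_of_axisym_slowInflow_C2_past` (classical profile pressure from `Past.exists_isSelfSimilarEulerProfile`, then (S37) past
  `NeedleRace.selfSimilar_ae_eq_zero_of_axisymNoSwirlC2_past`) — fillers for `IsPastSelfSimilarClassical`.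

WHAT THIS IS NOT: not NS regularity, not the crux E — strata of the crux CLASS 19832 (MODEL lattice; E/NS strata) `--supports` stmt-19832; the swirling axisymmetric `C²` needle with
unbounded swirl AND fast inflow, and every non-axisymmetric needle, stay OPEN.  [cite: Chae2007CMPEuler, Thm 2.2 + Note added p. 6; ConstantinIgnatovaVicol2026Putative, §4.4]
-/

noncomputable section

-- flat `Theorems/<Route><Decl>…` files of one crux share the namespace of the crux (tree convention: `Summit.<S>.<S>.…`)
set_option linter.dupNamespace false

open MeasureTheory Set Filter Topology Metric Function InnerProductSpace
open scoped RealInnerProductSpace NNReal ContDiff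

namespace Summit.NavierStokesRegularity.NavierStokesRegularity.Theorems.PowerGaugeEulerLiouville

open Literature.Analysis Literature.Analysis.FluidPDE Literature.Analysis.FunctionSpaces

namespace SwirlRatchet

variable {γ : ℝ} {U : EuclideanSpace ℝ (Fin 3) → EuclideanSpace ℝ (Fin 3)} {P : EuclideanSpace ℝ (Fin 3) → ℝ}

/-! ### Size of the swirl and of backward orbits -/

/-- **One-sided Grönwall for backward orbits**: `Y' = −W(Y)` on `[0, ∞)` (right derivative at `0`) and `⟪z, W z⟫ ≥ −(c₁‖z‖² + D)` everywhere give
`‖Y t‖² ≤ gronwallBound ‖Y 0‖² (2c₁) (2D) t`. [folklore] -/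
theorem norm_sq_backward_orbit_le {W : EuclideanSpace ℝ (Fin 3) → EuclideanSpace ℝ (Fin 3)}
    {Y : ℝ → EuclideanSpace ℝ (Fin 3)} (hY : ∀ t, 0 ≤ t → HasDerivWithinAt Y (-(W (Y t))) (Ici 0) t)
    {c₁ D : ℝ} (hslow : ∀ z, -(c₁ * ‖z‖ ^ 2 + D) ≤ ⟪z, W z⟫) {t : ℝ} (ht : 0 ≤ t) :
    ‖Y t‖ ^ 2 ≤ gronwallBound (‖Y 0‖ ^ 2) (2 * c₁) (2 * D) t := by
  set f : ℝ → ℝ := fun s => ‖Y s‖ ^ 2 with hf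
  have hder : ∀ s, 0 ≤ s → HasDerivWithinAt f (2 * ⟪Y s, -(W (Y s))⟫) (Ici s) s :=
    fun s hs => ((hY s hs).mono (Ici_subset_Ici.2 hs)).norm_sq
  have hcont : ContinuousOn f (Icc 0 t) := fun s hs => ((hY s hs.1).norm_sq.continuousWithinAt).mono fun r hr => hr.1
  have hf' : ∀ s ∈ Ico 0 t, ∀ r, 2 * ⟪Y s, -(W (Y s))⟫ < r → ∃ᶠ z in 𝓝[>] s, (z - s)⁻¹ * (f z - f s) < r := by
    intro s hs r hr
    refine ((hder s hs.1).liminf_right_slope_le hr).mono fun z hz => ?_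
    rwa [slope_def_field, div_eq_inv_mul] at hz
  have hbound : ∀ s ∈ Ico 0 t, 2 * ⟪Y s, -(W (Y s))⟫ ≤ 2 * c₁ * f s + 2 * D := by
    intro s _
    rw [inner_neg_right]
    have := hslow (Y s)
    simp only [hf]
    linarith
  have h := le_gronwallBound_of_liminf_deriv_right_le hcont hf' (le_of_eq rfl) hbound t (right_mem_Icc.2 ht)
  rwa [sub_zero] at h

/-- `gronwallBound δ K ε t ≤ (δ + ε/K) e^{Kt}` for `K > 0`, `ε ≥ 0`. [folklore] -/
theorem gronwallBound_le_mul_exp {δ K ε t : ℝ} (hK : 0 < K) (hε : 0 ≤ ε) :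
    gronwallBound δ K ε t ≤ (δ + ε / K) * Real.exp (K * t) := by
  rw [gronwallBound_of_K_ne_0 hK.ne']
  have h1 : 0 ≤ ε / K := div_nonneg hε hK.le
  nlinarith [Real.exp_pos (K * t)]

/-! ### Slow channels carry no swirl -/

/-- **SLOW INFLOW ⇒ NO SWIRL** (`γ < ½`).  `(U, P)` a `C²` self-similar Euler profile (CIV (3.3)), `U` axisymmetric of linear growth `‖U y‖ ≤ K₁(1+‖y‖)`, and the
INFLOW BOUND `⟪z, γz + U z⟫ ≥ −(c₁‖z‖² + D)` for all `z` with `0 < c₁`, `2c₁ < 1 − 2γ`.  Then `U` is swirl-free: along the global backward orbit from a point with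
`Γ ≠ 0`, `|Γ(y)|e^{(1−2γ)t} = |Γ(Y t)| ≤ ‖Y t‖‖U(Y t)‖ ≤ C e^{2c₁ t}` — absurd for large `t`. [cite: Chae2007CMPEuler, Thm 2.2 + Note added p. 6] -/
theorem hasNoSwirl_of_slowInflow (h : IsSelfSimilarEulerProfile γ 0 U P) (hU : IsAxisymmetric U)
    {K₁ : ℝ} (hlin : ∀ y, ‖U y‖ ≤ K₁ * (1 + ‖y‖)) {c₁ D : ℝ} (hc₁ : 0 < c₁) (hgap : 2 * c₁ < 1 - 2 * γ)
    (hslow : ∀ z, -(c₁ * ‖z‖ ^ 2 + D) ≤ ⟪z, selfSimilarTransport γ 0 U z⟫) : HasNoSwirl U := by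
  intro y
  by_contra hne
  have hK₁ : 0 ≤ K₁ := by
    have h0 := hlin 0
    rw [norm_zero, add_zero, mul_one] at h0
    exact (norm_nonneg _).trans h0
  have hD : 0 ≤ D := by
    have h0 := hslow 0
    simp only [norm_zero, inner_zero_left] at h0
    linarith
  -- the backward orbit
  set Wb : EuclideanSpace ℝ (Fin 3) → EuclideanSpace ℝ (Fin 3) := fun z => -(selfSimilarTransport γ 0 U z) with hWb
  have hWb1 : ContDiff ℝ 1 Wb :=
    (PowerGaugeEulerLiouville.Kelvin.contDiff_selfSimilarTransport (h.contDiff_velocity.of_le (by norm_num))).neg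
  have hgrowth : ∀ z, ‖Wb z‖ ≤ (|γ| + K₁) * ‖z‖ + K₁ := by
    intro z
    rw [hWb]
    simp only [norm_neg, selfSimilarTransport_apply, sub_zero]
    calc ‖γ • z + U z‖ ≤ ‖γ • z‖ + ‖U z‖ := norm_add_le _ _
      _ ≤ |γ| * ‖z‖ + K₁ * (1 + ‖z‖) := by rw [norm_smul, Real.norm_eq_abs]; exact add_le_add le_rfl (hlin z)
      _ = (|γ| + K₁) * ‖z‖ + K₁ := by ring
  obtain ⟨Y, hY0, hY, -⟩ := Loc.exists_forward_solution_of_linearGrowth hWb1 (by positivity) hK₁ hgrowth y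
  have hY' : ∀ t, 0 ≤ t → HasDerivWithinAt Y (-(selfSimilarTransport γ 0 U (Y t))) (Ici 0) t :=
    fun t ht => by simpa only [hWb] using hY t ht
  have hratchet : ∀ t, 0 ≤ t → swirl U (Y t) = swirl U y * Real.exp ((1 - 2 * γ) * t) := by
    intro t ht
    rw [← hY0]
    exact swirl_backward_orbit h hU hY' ht
  -- size of the orbit and of the swirl along it
  set M₀ : ℝ := ‖y‖ ^ 2 + D / c₁ with hM₀
  have hM₀0 : 0 ≤ M₀ := by rw [hM₀]; positivity
  have horbit : ∀ t, 0 ≤ t → ‖Y t‖ ^ 2 ≤ M₀ * Real.exp (2 * c₁ * t) := by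
    intro t ht
    have h1 := norm_sq_backward_orbit_le hY' hslow ht
    rw [hY0] at h1
    refine h1.trans ?_
    have h2 := gronwallBound_le_mul_exp (δ := ‖y‖ ^ 2) (t := t) (by positivity : 0 < 2 * c₁) (by positivity : 0 ≤ 2 * D)
    have h3 : ‖y‖ ^ 2 + 2 * D / (2 * c₁) = M₀ := by rw [hM₀]; field_simp
    rwa [h3] at h2
  set C : ℝ := K₁ * (1 + 2 * M₀) with hC
  have hswirl : ∀ t, 0 ≤ t → |swirl U (Y t)| ≤ C * Real.exp (2 * c₁ * t) := by
    intro t ht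
    have hx : 0 ≤ ‖Y t‖ := norm_nonneg _
    have he : 1 ≤ Real.exp (2 * c₁ * t) := Real.one_le_exp (by positivity)
    calc |swirl U (Y t)| ≤ ‖Y t‖ * ‖U (Y t)‖ := by
          rw [swirl_eq_inner_rotGen]
          exact (abs_real_inner_le_norm _ _).trans
            (mul_le_mul_of_nonneg_right (PineauVicol2026.norm_rotGen_le (Y t)) (norm_nonneg _))
      _ ≤ ‖Y t‖ * (K₁ * (1 + ‖Y t‖)) := mul_le_mul_of_nonneg_left (hlin _) hx
      _ = K₁ * (‖Y t‖ + ‖Y t‖ ^ 2) := by ring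
      _ ≤ K₁ * (1 + 2 * ‖Y t‖ ^ 2) := by
          apply mul_le_mul_of_nonneg_left _ hK₁; nlinarith [sq_nonneg (‖Y t‖ - 1)]
      _ ≤ K₁ * (1 + 2 * (M₀ * Real.exp (2 * c₁ * t))) := by gcongr; exact horbit t ht
      _ ≤ C * Real.exp (2 * c₁ * t) := by rw [hC]; nlinarith [mul_nonneg hK₁ hM₀0]
  -- the race between the ratchet `e^{(1−2γ)t}` and the escape `e^{2c₁t}`
  have hpos : 0 < |swirl U y| := abs_pos.2 hne
  set δ : ℝ := (1 - 2 * γ) - 2 * c₁ with hδ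
  have hδ0 : 0 < δ := by rw [hδ]; linarith
  have hC0 : 0 ≤ C := by rw [hC]; positivity
  set t : ℝ := (C / |swirl U y| + 1) / δ with htdef
  have ht0 : 0 ≤ t := by rw [htdef]; positivity
  have hexp : C / |swirl U y| + 1 < Real.exp (δ * t) := by
    have h1 : δ * t = C / |swirl U y| + 1 := by rw [htdef]; field_simp
    rw [h1]
    linarith [Real.add_one_le_exp (C / |swirl U y| + 1)]
  have hkey : |swirl U y| * Real.exp ((1 - 2 * γ) * t) ≤ C * Real.exp (2 * c₁ * t) := by
    have h1 := hswirl t ht0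
    rwa [hratchet t ht0, abs_mul, abs_of_pos (Real.exp_pos _)] at h1
  have hsplit : Real.exp ((1 - 2 * γ) * t) = Real.exp (δ * t) * Real.exp (2 * c₁ * t) := by
    rw [← Real.exp_add]; congr 1; rw [hδ]; ring
  rw [hsplit, ← mul_assoc] at hkey
  have hkey' : |swirl U y| * Real.exp (δ * t) ≤ C := le_of_mul_le_mul_right hkey (Real.exp_pos _)
  have : C < |swirl U y| * Real.exp (δ * t) := by
    have h2 : C < |swirl U y| * (C / |swirl U y| + 1) := by
      rw [mul_add, mul_div_cancel₀ _ hpos.ne', mul_one]; linarith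
    exact h2.trans (mul_lt_mul_of_pos_left hexp hpos)
  linarith

end SwirlRatchet

/-! ### Member forms: centred slow inflow, and the past twins -/

namespace SwirlRatchet

variable {u : ℝ → EuclideanSpace ℝ (Fin 3) → EuclideanSpace ℝ (Fin 3)} {p : ℝ → EuclideanSpace ℝ (Fin 3) → ℝ}
  {H : ℝ → EuclideanSpace ℝ (Fin 3) → EuclideanSpace ℝ (Fin 3) →L[ℝ] EuclideanSpace ℝ (Fin 3)} {c : ℝ≥0}
  {V : EuclideanSpace ℝ (Fin 3) → EuclideanSpace ℝ (Fin 3)} {P : EuclideanSpace ℝ (Fin 3) → ℝ}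

/-- `1 − 2/(2+ρ) = ρ/(2+ρ)`. [folklore] -/
theorem one_sub_two_mul_exponent {ρ : ℝ} (hρ : 0 < ρ) : 1 - 2 * (1 / (2 + ρ)) = ρ / (2 + ρ) := by
  have h2ρ : (2 : ℝ) + ρ ≠ 0 := by linarith
  field_simp
  ring

/-- **MEMBER FORM (centred): AXISYMMETRIC `C²` PROFILE OF LINEAR GROWTH WITH SLOW INFLOW ⇒ TRIVIAL.**  Crux binders verbatim (`0 < ρ ≤ ½`) + exactly self-similar ansatz
about the origin + `ContDiff ℝ 2 V` + `IsAxisymmetric V` + `‖V y‖ ≤ K₁(1+‖y‖)` + inflow bound `⟪z, z/(2+ρ) + V z⟫ ≥ −(c₁‖z‖² + D)` with `0 < c₁`, `2c₁ < ρ/(2+ρ)` ⇒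
`u = 0` a.e. (ratchet ⇒ swirl-free ⇒ (S37)). [cite: Chae2007CMPEuler, Thm 2.2 + Note added p. 6] -/
theorem selfSimilar_ae_eq_zero_of_axisym_slowInflow_C2 {ρ : ℝ} (hρ : 0 < ρ) (hρ1 : ρ ≤ 1 / 2)
    (hsw : IsSuitableWeakSolutionOn (slab (EuclideanSpace ℝ (Fin 3)) (Iio 0) isOpen_Iio) 0 0 u p)
    (hH : HasWeakSpatialGradientOn (slab (EuclideanSpace ℝ (Fin 3)) (Iio 0) isOpen_Iio) u H)
    (hgauge : ∀ a : ℝ, 0 < a →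
      ENNReal.ofReal (a ^ (2 * ρ)) * cknA a (0 : ℝ × EuclideanSpace ℝ (Fin 3)) u +
          ENNReal.ofReal (a ^ ρ) * cknE a (0 : ℝ × EuclideanSpace ℝ (Fin 3)) H +
        ENNReal.ofReal (a ^ (2 * ρ)) * cknD a (0 : ℝ × EuclideanSpace ℝ (Fin 3)) p ≤ (c : ENNReal))
    (hu : ∀ τ : ℝ, τ < 0 → u τ = selfSimilarCollapse (1 / (2 + ρ)) 0 V τ)
    (hp : ∀ τ : ℝ, τ < 0 → p τ = selfSimilarCollapsePressure (1 / (2 + ρ)) 0 P τ)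
    (hV : ContDiff ℝ 2 V) (hax : IsAxisymmetric V)
    (hlin : ∃ K₁ : ℝ, ∀ y, ‖V y‖ ≤ K₁ * (1 + ‖y‖))
    (hslow : ∃ c₁ D : ℝ, 0 < c₁ ∧ 2 * c₁ < ρ / (2 + ρ) ∧
      ∀ z : EuclideanSpace ℝ (Fin 3), -(c₁ * ‖z‖ ^ 2 + D) ≤ ⟪z, selfSimilarTransport (1 / (2 + ρ)) 0 V z⟫) :
    uncurry u =ᵐ[volume.restrict (Iio (0 : ℝ) ×ˢ (univ : Set (EuclideanSpace ℝ (Fin 3))))] 0 := by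
  obtain ⟨K₁, hK₁⟩ := hlin
  obtain ⟨c₁, D, hc₁, hgap, hsl⟩ := hslow
  have hρ1' : ρ < 1 := by linarith
  rw [← one_sub_two_mul_exponent hρ] at hgap
  -- a classical pressure of the profile
  have hD : ∀ a : ℝ, 0 < a → ENNReal.ofReal (a ^ (2 * ρ)) *
      cknD a (0 : ℝ × EuclideanSpace ℝ (Fin 3)) p ≤ (c : ENNReal) :=
    fun a ha => le_trans le_add_self (hgauge a ha)
  have hpm : AEStronglyMeasurable (uncurry p)
      (volume.restrict (Iio (0 : ℝ) ×ˢ (univ : Set (EuclideanSpace ℝ (Fin 3))))) := by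
    have := hsw.distributional.2.2.1.aestronglyMeasurable
    simpa [slab] using this
  have hPm := aestronglyMeasurable_pressureProfile hpm hp
  have hDprof := profile_pressure_weight_of_gaugeD hρ hρ1' hpm hp hD
  have hP1 : LocallyIntegrable P volume :=
    EnergySaturation.locallyIntegrable_pressure_of_weight hρ1' hPm
      (ENNReal.mul_ne_top ENNReal.ofReal_ne_top ENNReal.coe_ne_top) hDprof
  obtain ⟨P', hprof⟩ := WeakToClassical.exists_isSelfSimilarEulerProfile_of_contDiff hsw.distributional hu hp hV hP1
  have hns : HasNoSwirl V := hasNoSwirl_of_slowInflow hprof hax hK₁ hc₁ hgap hsl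
  exact NeedleRace.selfSimilar_ae_eq_zero_of_axisymNoSwirlC2 hρ hρ1 hsw hH hgauge hu hp hV hax hns

/-- **PAST TWIN of `selfSimilar_ae_eq_zero_of_axisym_boundedSwirl_C2`**: velocity AND pressure exactly self-similar about `(T, x₀)` on a past window `τ < T₁`
(`T₁ ≤ 0`, `T₁ ≤ T`) with an axisymmetric `C²` profile of linear growth and bounded swirl ⇒ trivial (classical profile pressure from the far past —
`Past.exists_isSelfSimilarEulerProfile`; ratchet; (S37) past).  With ns-ezl-w3 g2's past slaving `PressureSlaving.inClass_pastSelfSimilarPressure` the pressure clause is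
disposable (velocity-only filler, as in v58 (b)). [cite: Chae2007CMPEuler, Thm 2.2 + Note added p. 6] -/
theorem selfSimilar_ae_eq_zero_of_axisym_boundedSwirl_C2_past {ρ T T₁ : ℝ} (hρ : 0 < ρ) (hρ1 : ρ ≤ 1 / 2)
    (hT₁ : T₁ ≤ 0) (hTT₁ : T₁ ≤ T) (x₀ : EuclideanSpace ℝ (Fin 3))
    (hsw : IsSuitableWeakSolutionOn (slab (EuclideanSpace ℝ (Fin 3)) (Iio 0) isOpen_Iio) 0 0 u p)
    (hH : HasWeakSpatialGradientOn (slab (EuclideanSpace ℝ (Fin 3)) (Iio 0) isOpen_Iio) u H)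
    (hgauge : ∀ a : ℝ, 0 < a →
      ENNReal.ofReal (a ^ (2 * ρ)) * cknA a (0 : ℝ × EuclideanSpace ℝ (Fin 3)) u +
          ENNReal.ofReal (a ^ ρ) * cknE a (0 : ℝ × EuclideanSpace ℝ (Fin 3)) H +
        ENNReal.ofReal (a ^ (2 * ρ)) * cknD a (0 : ℝ × EuclideanSpace ℝ (Fin 3)) p ≤ (c : ENNReal))
    (hu : ∀ τ : ℝ, τ < T₁ → u τ = fun x => selfSimilarCollapse (1 / (2 + ρ)) T V τ (x - x₀))
    (hp : ∀ τ : ℝ, τ < T₁ → p τ = fun x => selfSimilarCollapsePressure (1 / (2 + ρ)) T P τ (x - x₀))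
    (hV : ContDiff ℝ 2 V) (hax : IsAxisymmetric V)
    (hlin : ∃ K₁ : ℝ, ∀ y, ‖V y‖ ≤ K₁ * (1 + ‖y‖)) (hbdd : ∃ B : ℝ, ∀ y, |swirl V y| ≤ B) :
    uncurry u =ᵐ[volume.restrict (Iio (0 : ℝ) ×ˢ (univ : Set (EuclideanSpace ℝ (Fin 3))))] 0 := by
  obtain ⟨K₁, hK₁⟩ := hlin
  obtain ⟨B, hB⟩ := hbdd
  have hγ2 : 1 / (2 + ρ) < 1 / 2 := one_div_lt_one_div_of_lt two_pos (by linarith)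
  obtain ⟨P', hprof⟩ := Past.exists_isSelfSimilarEulerProfile hρ hT₁ hTT₁ hsw.distributional hu hp hV
  have hns : HasNoSwirl V := hasNoSwirl_of_bounded_swirl hprof hax hγ2 hK₁ hB
  exact NeedleRace.selfSimilar_ae_eq_zero_of_axisymNoSwirlC2_past hρ hρ1 hT₁ hTT₁ x₀ hsw hH hgauge hu hp hV hax hns

/-- **PAST TWIN of `selfSimilar_ae_eq_zero_of_axisym_slowInflow_C2`** (same shape, inflow bound instead of the swirl bound). [cite: Chae2007CMPEuler, Thm 2.2 + Note added p. 6] -/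
theorem selfSimilar_ae_eq_zero_of_axisym_slowInflow_C2_past {ρ T T₁ : ℝ} (hρ : 0 < ρ) (hρ1 : ρ ≤ 1 / 2)
    (hT₁ : T₁ ≤ 0) (hTT₁ : T₁ ≤ T) (x₀ : EuclideanSpace ℝ (Fin 3))
    (hsw : IsSuitableWeakSolutionOn (slab (EuclideanSpace ℝ (Fin 3)) (Iio 0) isOpen_Iio) 0 0 u p)
    (hH : HasWeakSpatialGradientOn (slab (EuclideanSpace ℝ (Fin 3)) (Iio 0) isOpen_Iio) u H)
    (hgauge : ∀ a : ℝ, 0 < a →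
      ENNReal.ofReal (a ^ (2 * ρ)) * cknA a (0 : ℝ × EuclideanSpace ℝ (Fin 3)) u +
          ENNReal.ofReal (a ^ ρ) * cknE a (0 : ℝ × EuclideanSpace ℝ (Fin 3)) H +
        ENNReal.ofReal (a ^ (2 * ρ)) * cknD a (0 : ℝ × EuclideanSpace ℝ (Fin 3)) p ≤ (c : ENNReal))
    (hu : ∀ τ : ℝ, τ < T₁ → u τ = fun x => selfSimilarCollapse (1 / (2 + ρ)) T V τ (x - x₀))
    (hp : ∀ τ : ℝ, τ < T₁ → p τ = fun x => selfSimilarCollapsePressure (1 / (2 + ρ)) T P τ (x - x₀))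
    (hV : ContDiff ℝ 2 V) (hax : IsAxisymmetric V)
    (hlin : ∃ K₁ : ℝ, ∀ y, ‖V y‖ ≤ K₁ * (1 + ‖y‖))
    (hslow : ∃ c₁ D : ℝ, 0 < c₁ ∧ 2 * c₁ < ρ / (2 + ρ) ∧
      ∀ z : EuclideanSpace ℝ (Fin 3), -(c₁ * ‖z‖ ^ 2 + D) ≤ ⟪z, selfSimilarTransport (1 / (2 + ρ)) 0 V z⟫) :
    uncurry u =ᵐ[volume.restrict (Iio (0 : ℝ) ×ˢ (univ : Set (EuclideanSpace ℝ (Fin 3))))] 0 := by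
  obtain ⟨K₁, hK₁⟩ := hlin
  obtain ⟨c₁, D, hc₁, hgap, hsl⟩ := hslow
  rw [← one_sub_two_mul_exponent hρ] at hgap
  obtain ⟨P', hprof⟩ := Past.exists_isSelfSimilarEulerProfile hρ hT₁ hTT₁ hsw.distributional hu hp hV
  have hns : HasNoSwirl V := hasNoSwirl_of_slowInflow hprof hax hK₁ hc₁ hgap hsl
  exact NeedleRace.selfSimilar_ae_eq_zero_of_axisymNoSwirlC2_past hρ hρ1 hT₁ hTT₁ x₀ hsw hH hgauge hu hp hV hax hns

end SwirlRatchet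

end Summit.NavierStokesRegularity.NavierStokesRegularity.Theorems.PowerGaugeEulerLiouville

end
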